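import Mathlib
import HarnessLib
import Literature.Geometry.Lorentzian.KerrWaveEnergyProofs
import Literature.Geometry.Lorentzian.KerrTimeDerivative
import Summits.FinalStateConjecture.FinalStateConjecture.Theorems.ZeroEnergyKerrOrBombKerrModeStabilityData

/-!
# Route ZeroEnergyKerrOrBomb · item `KerrModeStability` — calculus for the slice Lagrangian identity

Helper file for item stmt-FinalStateConjecture-10024 (`KerrModeStability`): the calculus facts
entering the integration by parts `∑ᵢ ∫ ∂ᵢ(ζ² ψ̃ J^{i+1}[ψ̃]) dy = 0` on the slice `{t* = 0}`
(far region of the Kerr–Schild chart), where `J^μ[ψ̃] = ∑_ν g^{μν} ∂_ν ψ̃` is the current of the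
divergence form `□_g ψ̃ = ∑_μ ∂_μ J^μ[ψ̃]` (`Kerr.dalembertian_eq_divergence`):

* `kerr_contDiff_mul_of_tsupport` — smoothness of cut-off products;
* `kerr_annularCutoff_*` — the annular cut-off `ζ = u_{c,1} (1 − u_{R+1,1})` (tree's
  `radialTransition`): support, values, slope;
* `kerr_contDiffAt_current` — the current of a smooth function is smooth at chart points;
* `kerr_fderiv_timeDeriv_eq` — for a Killing-mode pair, `d(∂₀ψ̃) = ν dψ̃ − ω dχ̃` on the exterior;
* `kerr_sum_fderiv_current_succ` — `∑ᵢ ∂_{i+1} J^{i+1}[ψ̃] = −(ν J⁰[ψ̃] − ω J⁰[χ̃])` at exterior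
  points (`□_g ψ = 0`, `∂₀ J⁰ = J⁰[∂₀ψ̃]` by stationarity, `Kerr.fderiv_gradComp_basisVector_zero`);
* `kerr_fderiv_cutoff_sq_mul` — `∂ᵢ(ζ² ψ̃(0,·)) = 2ζ ∂ᵢζ ψ̃ + ζ² ∂_{i+1}ψ̃`.

No new definitions.
-/

noncomputable section

namespace Summit.FinalStateConjecture.FinalStateConjecture.Theorems

open Literature.Geometry.Lorentzian Set Filter MeasureTheory
open scoped Manifold ContDiff Topology

-- every `Summit.FinalStateConjecture.FinalStateConjecture.…` name repeats the summit = sub-problem segment (D-0017 layout)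
set_option linter.dupNamespace false

/-! ### Cut-off products -/

/-- **A cut-off makes a locally smooth function globally smooth**: if `ζ` is `C^n` with
topological support inside a set `Ω` at whose points `f` is `C^n`, then `ζ · f` is `C^n` on `E3`. -/
theorem kerr_contDiff_mul_of_tsupport {n : WithTop ℕ∞} {ζ f : E3 → ℝ} {Ω : Set E3}
    (hζ : ContDiff ℝ n ζ) (hs : tsupport ζ ⊆ Ω) (hf : ∀ y ∈ Ω, ContDiffAt ℝ n f y) :
    ContDiff ℝ n fun y ↦ ζ y * f y := by
  rw [contDiff_iff_contDiffAt]
  intro y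
  by_cases hy : y ∈ Ω
  · exact hζ.contDiffAt.mul (hf y hy)
  · have hy' : y ∉ tsupport ζ := fun h ↦ hy (hs h)
    have hev : (fun y ↦ ζ y * f y) =ᶠ[𝓝 y] fun _ ↦ 0 := by
      have : ζ =ᶠ[𝓝 y] 0 := notMem_tsupport_iff_eventuallyEq.mp hy'
      filter_upwards [this] with y' hy'
      rw [hy', Pi.zero_apply, zero_mul]
    exact (contDiffAt_const (c := (0 : ℝ))).congr_of_eventuallyEq hev

/-- Off the topological support of `ζ`, both `ζ` and its differential vanish, and so do a product
`ζ² f` and its differential. -/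
theorem kerr_eq_zero_of_notMem_tsupport {ζ f : E3 → ℝ} {y : E3} (hy : y ∉ tsupport ζ) :
    ζ y = 0 ∧ fderiv ℝ ζ y = 0 ∧ (fun y ↦ ζ y ^ 2 * f y) y = 0 ∧
      fderiv ℝ (fun y ↦ ζ y ^ 2 * f y) y = 0 := by
  have hev : ζ =ᶠ[𝓝 y] fun _ ↦ 0 := notMem_tsupport_iff_eventuallyEq.mp hy
  have h0 : ζ y = 0 := hev.eq_of_nhds
  have hev2 : (fun y ↦ ζ y ^ 2 * f y) =ᶠ[𝓝 y] fun _ ↦ 0 := by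
    filter_upwards [hev] with y' hy'
    rw [hy', zero_pow two_ne_zero, zero_mul]
  refine ⟨h0, ?_, by simp only [h0, zero_pow two_ne_zero, zero_mul], ?_⟩
  · rw [hev.fderiv_eq]; simp
  · rw [hev2.fderiv_eq]; simp

/-! ### The annular cut-off `ζ(y) = u_{c,1}(y) (1 − u_{R+1,1}(y))` -/

/-- The annular cut-off vanishes on `{‖y‖ ≤ c}`. -/
theorem kerr_annularCutoff_eq_zero_of_le {c R : ℝ} {y : E3} (hy : ‖y‖ ≤ c) :
    radialTransition c 1 y * (1 - radialTransition (R + 1) 1 y) = 0 := by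
  rw [radialTransition_of_norm_le one_pos hy, zero_mul]

/-- The annular cut-off vanishes on `{‖y‖ ≥ R + 2}`. -/
theorem kerr_annularCutoff_eq_zero_of_ge {c R : ℝ} {y : E3} (hy : R + 2 ≤ ‖y‖) :
    radialTransition c 1 y * (1 - radialTransition (R + 1) 1 y) = 0 := by
  rw [radialTransition_of_le_norm (c := R + 1) one_pos (by linarith), sub_self, mul_zero]

/-- The annular cut-off equals `1` on `{c + 1 ≤ ‖y‖ ≤ R + 1}`. -/
theorem kerr_annularCutoff_eq_one {c R : ℝ} {y : E3} (h1 : c + 1 ≤ ‖y‖) (h2 : ‖y‖ ≤ R + 1) :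
    radialTransition c 1 y * (1 - radialTransition (R + 1) 1 y) = 1 := by
  rw [radialTransition_of_le_norm one_pos h1, radialTransition_of_norm_le one_pos h2]; norm_num

/-- The annular cut-off takes values in `[0, 1]`. -/
theorem kerr_abs_annularCutoff_le (c R : ℝ) (y : E3) :
    |radialTransition c 1 y * (1 - radialTransition (R + 1) 1 y)| ≤ 1 := by
  have h0 := radialTransition_nonneg c 1 y
  have h1 := radialTransition_le_one c 1 y
  have h0' := radialTransition_nonneg (R + 1) 1 y
  have h1' := radialTransition_le_one (R + 1) 1 y
  rw [abs_le]; constructor <;> nlinarith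

/-- The annular cut-off is smooth (`c > 0`, `R + 1 > 0`). -/
theorem kerr_contDiff_annularCutoff {c R : ℝ} (hc : 0 < c) (hR : 0 < R + 1) {n : ℕ∞} :
    ContDiff ℝ n fun y : E3 ↦ radialTransition c 1 y * (1 - radialTransition (R + 1) 1 y) :=
  (contDiff_radialTransition hc one_pos).mul (contDiff_const.sub (contDiff_radialTransition hR one_pos))

/-- The annular cut-off has compact support (inside the closed ball of radius `R + 2`). -/
theorem kerr_hasCompactSupport_annularCutoff (c R : ℝ) :
    HasCompactSupport fun y : E3 ↦ radialTransition c 1 y * (1 - radialTransition (R + 1) 1 y) := by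
  refine HasCompactSupport.of_support_subset_isCompact (isCompact_closedBall (0 : E3) (R + 2))
    fun y hy ↦ ?_
  rw [Metric.mem_closedBall, dist_zero_right]
  by_contra h
  exact hy (kerr_annularCutoff_eq_zero_of_ge (le_of_lt (not_le.mp h)))

/-- The topological support of the annular cut-off lies in `{c ≤ ‖y‖}` (the function vanishes
on `{‖y‖ ≤ c}`, so its support lies in the closed set `{c ≤ ‖y‖}`… indeed in `{c < ‖y‖}`, whose
closure is contained in `{c ≤ ‖y‖}`). -/
theorem kerr_tsupport_annularCutoff_subset (c R : ℝ) :
    tsupport (fun y : E3 ↦ radialTransition c 1 y * (1 - radialTransition (R + 1) 1 y)) ⊆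
      {y : E3 | c ≤ ‖y‖} := by
  refine closure_minimal (fun y hy ↦ ?_) (isClosed_le continuous_const continuous_norm)
  by_contra hlt
  simp only [Set.mem_setOf_eq, not_le] at hlt
  exact hy (kerr_annularCutoff_eq_zero_of_le hlt.le)

/-- The topological support of the annular cut-off lies in the closed ball of radius `R + 2`. -/
theorem kerr_tsupport_annularCutoff_subset_closedBall (c R : ℝ) :
    tsupport (fun y : E3 ↦ radialTransition c 1 y * (1 - radialTransition (R + 1) 1 y)) ⊆
      Metric.closedBall (0 : E3) (R + 2) := by
  refine closure_minimal (fun y hy ↦ ?_) Metric.isClosed_closedBall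
  rw [Metric.mem_closedBall, dist_zero_right]
  by_contra hlt
  exact hy (kerr_annularCutoff_eq_zero_of_ge (le_of_lt (not_le.mp hlt)))

/-- **Slope of the annular cut-off**: `‖dζ‖ ≤ 2K` for a bound `K` of `|smoothTransition'|`
(product rule; each radial transition has slope `≤ K` and values in `[0, 1]`). -/
theorem kerr_norm_fderiv_annularCutoff_le {c R K : ℝ} (hc : 0 < c) (hR : 0 < R + 1)
    (hK : ∀ t, |deriv Real.smoothTransition t| ≤ K) (y : E3) :
    ‖fderiv ℝ (fun y : E3 ↦ radialTransition c 1 y * (1 - radialTransition (R + 1) 1 y)) y‖ ≤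
      2 * K := by
  have hK0 : 0 ≤ K := (abs_nonneg _).trans (hK 0)
  have hu : DifferentiableAt ℝ (radialTransition c 1) y :=
    (contDiff_radialTransition hc one_pos (n := 1)).differentiable (by simp) y
  have hv : DifferentiableAt ℝ (fun y ↦ 1 - radialTransition (R + 1) 1 y) y :=
    ((contDiff_const.sub (contDiff_radialTransition hR one_pos (n := 1))).differentiable
      (by simp)) y
  rw [fderiv_fun_mul hu hv]
  have h1 : ‖fderiv ℝ (radialTransition c 1) y‖ ≤ K := by
    simpa using norm_fderiv_radialTransition_le hc one_pos hK y
  have h2 : ‖fderiv ℝ (fun y ↦ 1 - radialTransition (R + 1) 1 y) y‖ ≤ K := by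
    rw [fderiv_const_sub, norm_neg]
    simpa using norm_fderiv_radialTransition_le hR one_pos hK y
  have hval1 : |radialTransition c 1 y| ≤ 1 := by
    rw [abs_le]; exact ⟨by linarith [radialTransition_nonneg c 1 y], radialTransition_le_one c 1 y⟩
  have hval2 : |1 - radialTransition (R + 1) 1 y| ≤ 1 := by
    rw [abs_le]
    exact ⟨by linarith [radialTransition_le_one (R + 1) 1 y],
      by linarith [radialTransition_nonneg (R + 1) 1 y]⟩
  calc ‖radialTransition c 1 y • fderiv ℝ (fun y ↦ 1 - radialTransition (R + 1) 1 y) y +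
        (1 - radialTransition (R + 1) 1 y) • fderiv ℝ (radialTransition c 1) y‖
      ≤ ‖radialTransition c 1 y • fderiv ℝ (fun y ↦ 1 - radialTransition (R + 1) 1 y) y‖ +
        ‖(1 - radialTransition (R + 1) 1 y) • fderiv ℝ (radialTransition c 1) y‖ := norm_add_le _ _
    _ ≤ 1 * K + 1 * K := by
        rw [norm_smul, norm_smul, Real.norm_eq_abs, Real.norm_eq_abs]
        gcongr
    _ = 2 * K := by ring

/-! ### The current `J^μ[ψ̃] = ∑_ν g^{μν} ∂_ν ψ̃` -/

/-- **The current of a smooth function is smooth** at every chart point: for `ψ` smooth on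
`Kerr.region a r₀` with extension by zero `ψ̃` and `x ∈ Kerr.region a r₀`,
`z ↦ ∑_ν g^{μν}(z) ∂_ν ψ̃(z)` is `C^∞` at `x` (`g^{μν}` is analytic on `{r > 0}`,
`Kerr.contDiffAt_inverseMetric`; `∂_ν ψ̃` is smooth at chart points). -/
theorem kerr_contDiffAt_current {M a r₀ : ℝ} {ψ : Kerr.region a r₀ → ℝ}
    (hψ : ContMDiff 𝓘(ℝ, E4) 𝓘(ℝ, ℝ) ∞ ψ) (x : Kerr.region a r₀) (μ : Fin 4) :
    ContDiffAt ℝ ∞ (fun z : E4 ↦ ∑ ν, Kerr.inverseMetric M a z μ ν *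
      fderiv ℝ (Function.extend Subtype.val ψ 0) z (E4.basisVector ν)) x := by
  have hx : 0 < Kerr.radius a x := Kerr.radius_pos_of_mem_region x.2
  refine ContDiffAt.sum fun ν _ ↦ ?_
  exact (Kerr.contDiffAt_inverseMetric M a hx μ ν).mul
    (contDiffAt_fderiv_apply_const_infty (contDiffAt_extend hψ x) _)

/-- **The differential of the time derivative of a Killing-mode pair**: if `∂_{t*}ψ = νψ − ωχ`
on `{r > r₊}` (as manifold derivatives of smooth `ψ, χ` on `Kerr.region a r₀`), then at every
point `x` with `r > r₊`, `d(∂₀ψ̃)(x) = ν dψ̃(x) − ω dχ̃(x)` for the extensions by zero (the identity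
`∂₀ψ̃ = νψ̃ − ωχ̃` holds on the open set `{r > r₊} ∩ Kerr.region a r₀`, so it can be
differentiated). -/
theorem kerr_fderiv_timeDeriv_eq {M a r₀ ν w : ℝ} {ψ χ : Kerr.region a r₀ → ℝ}
    (hψ : ContMDiff 𝓘(ℝ, E4) 𝓘(ℝ, ℝ) ∞ ψ) (hχ : ContMDiff 𝓘(ℝ, E4) 𝓘(ℝ, ℝ) ∞ χ)
    (heig : ∀ x : Kerr.region a r₀, Kerr.rPlus M a < Kerr.radius a x.1 →
      mfderiv 𝓘(ℝ, E4) 𝓘(ℝ, ℝ) ψ x (Kerr.stationaryField a r₀ x) = ν * ψ x - w * χ x)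
    (x : Kerr.region a r₀) (hx : Kerr.rPlus M a < Kerr.radius a x.1) :
    fderiv ℝ (fun z ↦ fderiv ℝ (Function.extend Subtype.val ψ 0) z (E4.basisVector 0)) x =
      ν • fderiv ℝ (Function.extend Subtype.val ψ 0) x -
        w • fderiv ℝ (Function.extend Subtype.val χ 0) x := by
  set Φ : E4 → ℝ := Function.extend Subtype.val ψ 0 with hΦ_def
  set X : E4 → ℝ := Function.extend Subtype.val χ 0 with hX_def
  have hΦd : ∀ y : Kerr.region a r₀, DifferentiableAt ℝ Φ y := fun y ↦
    (contDiffAt_extend hψ y).differentiableAt (by simp)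
  have hXd : ∀ y : Kerr.region a r₀, DifferentiableAt ℝ X y := fun y ↦
    (contDiffAt_extend hχ y).differentiableAt (by simp)
  have hopen : IsOpen {z : E4 | Kerr.rPlus M a < Kerr.radius a z ∧ z ∈ Kerr.region a r₀} :=
    (isOpen_lt continuous_const (Kerr.continuous_radius a)).inter (Kerr.region a r₀).isOpen
  have hev : (fun z ↦ fderiv ℝ Φ z (E4.basisVector 0)) =ᶠ[𝓝 (x : E4)]
      fun z ↦ ν * Φ z - w * X z := by
    filter_upwards [hopen.mem_nhds ⟨hx, x.2⟩] with z hz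
    have h := heig ⟨z, hz.2⟩ hz.1
    rw [OpensChart.mfderiv_eq _ ψ Φ (extend_rep ψ) (hΦd ⟨z, hz.2⟩), extend_rep ψ, extend_rep χ]
      at h
    exact h
  rw [hev.fderiv_eq]
  rw [fderiv_fun_sub ((hΦd x).const_mul _) ((hXd x).const_mul _), fderiv_const_mul (hΦd x),
    fderiv_const_mul (hXd x)]

/-- **The spatial divergence of the current at an exterior point**: for a Killing-mode pair as
above with `□_g ψ = 0` at `x` (`r > r₊`), `∑ᵢ ∂_{i+1} J^{i+1}[ψ̃](x) = −(ν J⁰[ψ̃](x) − ω J⁰[χ̃](x))`: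
`∑_μ ∂_μ J^μ[ψ̃] = □_g ψ = 0` (`Kerr.dalembertian_eq_divergence`), and `∂₀ J⁰[ψ̃] = J⁰[∂₀ψ̃]`
(stationarity of `g^{μν}`, `Kerr.fderiv_gradComp_basisVector_zero`) `= ν J⁰[ψ̃] − ω J⁰[χ̃]`
(`kerr_fderiv_timeDeriv_eq`). -/
theorem kerr_sum_fderiv_current_succ [Kerr.Facts] [Kerr.SliceFacts] {M a r₀ ν w : ℝ}
    {ψ χ : Kerr.region a r₀ → ℝ}
    (hψ : ContMDiff 𝓘(ℝ, E4) 𝓘(ℝ, ℝ) ∞ ψ) (hχ : ContMDiff 𝓘(ℝ, E4) 𝓘(ℝ, ℝ) ∞ χ)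
    (heig : ∀ x : Kerr.region a r₀, Kerr.rPlus M a < Kerr.radius a x.1 →
      mfderiv 𝓘(ℝ, E4) 𝓘(ℝ, ℝ) ψ x (Kerr.stationaryField a r₀ x) = ν * ψ x - w * χ x)
    (x : Kerr.region a r₀) (hx : Kerr.rPlus M a < Kerr.radius a x.1)
    (hsol : (Kerr.smoothMetric M a r₀).toPseudoRiemannianMetric.dalembertian ψ x = 0) :
    ∑ i : Fin 3, fderiv ℝ (fun z : E4 ↦ ∑ ν', Kerr.inverseMetric M a z i.succ ν' *
        fderiv ℝ (Function.extend Subtype.val ψ 0) z (E4.basisVector ν')) x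
        (E4.basisVector i.succ) =
      -(ν * (∑ ν', Kerr.inverseMetric M a x 0 ν' *
          fderiv ℝ (Function.extend Subtype.val ψ 0) x (E4.basisVector ν')) -
        w * (∑ ν', Kerr.inverseMetric M a x 0 ν' *
          fderiv ℝ (Function.extend Subtype.val χ 0) x (E4.basisVector ν'))) := by
  set Φ : E4 → ℝ := Function.extend Subtype.val ψ 0 with hΦ_def
  set X : E4 → ℝ := Function.extend Subtype.val χ 0 with hX_def
  have hr : 0 < Kerr.radius a x := Kerr.radius_pos_of_mem_region x.2
  have hΦ2 : ContDiffAt ℝ 2 Φ x := (contDiffAt_extend hψ x).of_le (WithTop.coe_le_coe.mpr le_top)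
  -- `∑_μ ∂_μ J^μ = □ψ = 0`
  have hdiv := Kerr.dalembertian_eq_divergence M a r₀ (extend_rep ψ) x hΦ2
  rw [hsol] at hdiv
  -- split off the time component
  rw [Fin.sum_univ_succ (n := 3)] at hdiv
  -- `∂₀ J⁰ = J⁰[∂₀Φ] = ν J⁰[Φ] − ω J⁰[X]`
  have h0 : fderiv ℝ (fun z : E4 ↦ ∑ ν', Kerr.inverseMetric M a z 0 ν' *
      fderiv ℝ Φ z (E4.basisVector ν')) x (E4.basisVector 0) =
      ν * (∑ ν', Kerr.inverseMetric M a x 0 ν' * fderiv ℝ Φ x (E4.basisVector ν')) -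
        w * (∑ ν', Kerr.inverseMetric M a x 0 ν' * fderiv ℝ X x (E4.basisVector ν')) := by
    rw [Kerr.fderiv_gradComp_basisVector_zero M a hr hΦ2 0]
    have hcomp : ∀ ν', fderiv ℝ (fun z ↦ fderiv ℝ Φ z (E4.basisVector 0)) x (E4.basisVector ν') =
        ν * fderiv ℝ Φ x (E4.basisVector ν') - w * fderiv ℝ X x (E4.basisVector ν') := by
      intro ν'
      rw [hΦ_def, hX_def, kerr_fderiv_timeDeriv_eq hψ hχ heig x hx]
      simp only [_root_.sub_apply, _root_.smul_apply, smul_eq_mul]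
    simp_rw [hcomp]
    rw [Finset.mul_sum, Finset.mul_sum, ← Finset.sum_sub_distrib]
    exact Finset.sum_congr rfl fun ν' _ ↦ by ring
  rw [h0] at hdiv
  linarith

/-- **The differential of the cut-off product on the slice**: for `ζ : E3 → ℝ` differentiable at
`y` and `F : E4 → ℝ` differentiable at `(0, y)`,
`∂ᵢ(ζ² F(0, ·))(y) = 2 ζ(y) ∂ᵢζ(y) F(0, y) + ζ(y)² ∂_{i+1}F(0, y)`. -/
theorem kerr_fderiv_cutoff_sq_mul {ζ : E3 → ℝ} {F : E4 → ℝ} {y : E3} (hζ : DifferentiableAt ℝ ζ y)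
    (hF : DifferentiableAt ℝ F (E4.ofTimeSpace 0 y)) (i : Fin 3) :
    fderiv ℝ (fun y ↦ ζ y ^ 2 * F (E4.ofTimeSpace 0 y)) y (EuclideanSpace.single i 1) =
      2 * ζ y * fderiv ℝ ζ y (EuclideanSpace.single i 1) * F (E4.ofTimeSpace 0 y) +
        ζ y ^ 2 * fderiv ℝ F (E4.ofTimeSpace 0 y) (E4.basisVector i.succ) := by
  have hFh : DifferentiableAt ℝ (fun y ↦ F (E4.ofTimeSpace 0 y)) y :=
    hF.comp y (E4.hasFDerivAt_ofTimeSpace 0 y).differentiableAt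
  have hζ2 : DifferentiableAt ℝ (fun y ↦ ζ y ^ 2) y := hζ.pow 2
  rw [fderiv_fun_mul hζ2 hFh]
  simp only [_root_.add_apply, _root_.smul_apply, smul_eq_mul]
  rw [kerr_fderiv_comp_ofTimeSpace_single hF i]
  have hpow : fderiv ℝ (fun y ↦ ζ y ^ 2) y (EuclideanSpace.single i 1) =
      2 * ζ y * fderiv ℝ ζ y (EuclideanSpace.single i 1) := by
    rw [show (fun y ↦ ζ y ^ 2) = fun y ↦ ζ y * ζ y from funext fun y ↦ sq (ζ y),
      fderiv_fun_mul hζ hζ]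
    simp only [_root_.add_apply, _root_.smul_apply, smul_eq_mul]
    ring
  rw [hpow]
  ring

/-! ### Slice bookkeeping used by the Lagrangian identity -/

/-- Continuity along the slice of a partial derivative of a function smooth at the slice point. -/
theorem kerr_continuousAt_fderiv_slice {F : E4 → ℝ} {y : E3} {n : WithTop ℕ∞}
    (hF : ContDiffAt ℝ n F (E4.ofTimeSpace 0 y)) (hn : 1 < n) (v : E4) :
    ContinuousAt (fun y ↦ fderiv ℝ F (E4.ofTimeSpace 0 y) v) y := by
  have h1 : ContinuousAt (fun z ↦ fderiv ℝ F z v) (E4.ofTimeSpace 0 y) :=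
    ((hF.fderiv_right (m := 0) (by simpa using hn.le)).continuousAt).clm_apply continuousAt_const
  have h2 : ContinuousAt (E4.ofTimeSpace 0) y := (E4.continuous_ofTimeSpace 0).continuousAt
  exact ContinuousAt.comp (g := fun z ↦ fderiv ℝ F z v) h1 h2

/-- The time components of a Killing-mode pair are controlled by the values:
`|νΦ₀ − ωX₀|, |ωΦ₀ + νX₀| ≤ (|ν| + |ω|) C_b` when `|Φ₀|, |X₀| ≤ C_b`. -/
theorem kerr_abs_timeComponents_le {ν w Φ₀ X₀ Cb : ℝ} (hΦ : |Φ₀| ≤ Cb) (hX : |X₀| ≤ Cb) :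
    |ν * Φ₀ - w * X₀| ≤ (|ν| + |w|) * Cb ∧ |w * Φ₀ + ν * X₀| ≤ (|ν| + |w|) * Cb := by
  constructor
  · calc |ν * Φ₀ - w * X₀| ≤ |ν * Φ₀| + |w * X₀| := abs_sub _ _
      _ = |ν| * |Φ₀| + |w| * |X₀| := by rw [abs_mul, abs_mul]
      _ ≤ |ν| * Cb + |w| * Cb := by gcongr
      _ = (|ν| + |w|) * Cb := by ring
  · calc |w * Φ₀ + ν * X₀| ≤ |w * Φ₀| + |ν * X₀| := abs_add_le _ _
      _ = |w| * |Φ₀| + |ν| * |X₀| := by rw [abs_mul, abs_mul]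
      _ ≤ |w| * Cb + |ν| * Cb := by gcongr
      _ = (|ν| + |w|) * Cb := by ring

/-- **Integration by parts on the slice for cut-off currents.** Let `Ω ⊆ E3` be open with
`{0} × Ω` inside the chart `Kerr.region a r₀`, `ζ : E3 → ℝ` with `ζ²` smooth, `tsupport ζ² ⊆ Ω` and
`tsupport ζ` bounded, and `J, F : E4 → ℝ` smooth at chart points. Then
`y ↦ ∂ᵢ(J(0,·))(y) · ζ² F(0,y) + J(0,y) · ∂ᵢ(ζ² F(0,·))(y)` is integrable with integral `0`
(`integral_fderiv_mul_add_mul_fderiv_eq_zero` with `V = J(0,·)` of class `C¹` on `Ω` and the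
compactly supported `C¹` function `ζ² F(0,·)`). -/
theorem kerr_slice_ibp {a r₀ ρ : ℝ} {Ω : Set E3} (hΩ : IsOpen Ω)
    (hΩreg : ∀ y ∈ Ω, E4.ofTimeSpace 0 y ∈ Kerr.region a r₀) {ζ : E3 → ℝ}
    (hζ2s : ContDiff ℝ ∞ fun y ↦ ζ y ^ 2) (hζ2ts : tsupport (fun y ↦ ζ y ^ 2) ⊆ Ω)
    (hζtc : tsupport ζ ⊆ Metric.closedBall (0 : E3) ρ)
    {J F : E4 → ℝ} (hJ : ∀ z : Kerr.region a r₀, ContDiffAt ℝ ∞ J z)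
    (hF : ∀ z : Kerr.region a r₀, ContDiffAt ℝ ∞ F z) (i : Fin 3) :
    Integrable (fun y ↦ fderiv ℝ (fun y ↦ J (E4.ofTimeSpace 0 y)) y (EuclideanSpace.single i 1) *
        (ζ y ^ 2 * F (E4.ofTimeSpace 0 y)) +
      J (E4.ofTimeSpace 0 y) *
        fderiv ℝ (fun y ↦ ζ y ^ 2 * F (E4.ofTimeSpace 0 y)) y (EuclideanSpace.single i 1)) ∧
    ∫ y, (fderiv ℝ (fun y ↦ J (E4.ofTimeSpace 0 y)) y (EuclideanSpace.single i 1) *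
        (ζ y ^ 2 * F (E4.ofTimeSpace 0 y)) +
      J (E4.ofTimeSpace 0 y) *
        fderiv ℝ (fun y ↦ ζ y ^ 2 * F (E4.ofTimeSpace 0 y)) y (EuclideanSpace.single i 1)) = 0 := by
  have hslice : ContDiff ℝ ∞ (E4.ofTimeSpace 0) := E4.contDiff_ofTimeSpace 0
  have hζ2supp : Function.support (fun y ↦ ζ y ^ 2) ⊆ Function.support ζ := fun y hy ↦ by
    simp only [Function.mem_support, ne_eq] at hy ⊢
    exact fun h ↦ hy (by rw [h, zero_pow two_ne_zero])
  have hV1 : ContDiffOn ℝ 1 (fun y ↦ J (E4.ofTimeSpace 0 y)) Ω := by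
    intro y hy
    have h : ContDiffAt ℝ ∞ (fun y ↦ J (E4.ofTimeSpace 0 y)) y :=
      (hJ ⟨_, hΩreg y hy⟩).comp y hslice.contDiffAt
    exact (h.of_le (by norm_cast)).contDiffWithinAt
  have hg1 : ContDiff ℝ 1 (fun y ↦ ζ y ^ 2 * F (E4.ofTimeSpace 0 y)) := by
    refine (kerr_contDiff_mul_of_tsupport (n := ∞) hζ2s hζ2ts fun y hy ↦ ?_).of_le (by norm_cast)
    exact (hF ⟨_, hΩreg y hy⟩).comp y hslice.contDiffAt
  have hsupp : Function.support (fun y ↦ ζ y ^ 2 * F (E4.ofTimeSpace 0 y)) ⊆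
      Function.support fun y ↦ ζ y ^ 2 := fun y hy ↦ by
    simp only [Function.mem_support, ne_eq] at hy ⊢
    exact fun h ↦ hy (by rw [h, zero_mul])
  have hgc : HasCompactSupport (fun y ↦ ζ y ^ 2 * F (E4.ofTimeSpace 0 y)) :=
    HasCompactSupport.of_support_subset_isCompact (isCompact_closedBall (0 : E3) ρ)
      fun y hy ↦ hζtc (subset_tsupport _ (hζ2supp (hsupp hy)))
  have hgts : tsupport (fun y ↦ ζ y ^ 2 * F (E4.ofTimeSpace 0 y)) ⊆ Ω :=
    (closure_mono hsupp).trans hζ2ts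
  exact integral_fderiv_mul_add_mul_fderiv_eq_zero hΩ hV1 hg1 hgc hgts i

end Summit.FinalStateConjecture.FinalStateConjecture.Theorems

end
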